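import Literature.NumberTheory.EllipticCurves.DeShalit1987.KatzMeasureMonomialLinesPAdic
import HarnessLib

/-!
# `ℤ_p`-lines of the `ℤ_p²`-tower on the two-variable Katz frame, II: the avatar identity
# `ρ̂(σ) = (1 + (ρ̂(γ) − 1))^{κ(σ)}` and the frame corollary `IsKatzMeasure₂ ⟹ IsKatzBranch` along every
# sub-`ℤ_p`-line (all PROVED; no named fact)

Sequel of `KatzMeasureMonomialLinesPAdic.lean` (binomial series, `p`-adic powers, the monomial line and
its values). de Shalit 1987, II.4.17 (52)–(54): the two-variable `G(χ; T₁, T₂)` restricts along every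
`ℤ_p`-line `κ` of the `ℤ_p²`-tower to the one-variable `G(χ₀; T)` of (52)–(53); the dictionary is
`ρ̂(γᵢ) = ρ̂(γ)^{κ(γᵢ)}` for the characters `ρ` of the line ("`ρ(γ₀^a) = ρ(γ₀)^a`").

* §3 the avatar identity: for `κ : ZpExtension K p` with topological generator `γ` and a rank-one framed
  Galois representation `r` factoring through `κ`: `σ ↦ r(σ)` is continuous, `‖r(σ)‖ = 1`,
  `‖r(γ) − 1‖ < 1` (a continuous character of the compact group `Γ_K` through a pro-`p` quotient takes
  principal-unit values: `r(γ)^{pᴺ} → 1`, and `ū^{pᴺ} = 1 ⟹ ū = 1` in the residue field of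
  characteristic `p`), and **`r(σ) = (1 + (r(γ) − 1))^{κ(σ)}`** (`ZpExtension.avatarValueAt_eq_onePlusPow`:
  both sides are continuous characters of `ℤ_p` — `κ` is a quotient map of compact Hausdorff spaces —
  agreeing on the dense subset `ℕ`).
* §4 **`IsKatzMeasure₂.isKatzBranch_monomialLine`**: if `G` is a `λ`-twisted two-variable frame for
  `(κ₁, κ₂; γ₁, γ₂)` and `κ` is a `ℤ_p`-quotient of `Γ_K` through the pair (`ker κ₁ ∩ ker κ₂ ≤ ker κ`) with
  generator `γ`, then `monomialLine (κ γ₁) (κ γ₂) G` is a `λ`-twisted `κ`-branch at `γ`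
  (`DeShalit1987.IsKatzBranch`) — (52) along an ARBITRARY line of (54) (the inner line
  `IsKatzMeasure₂.isKatzBranch_constantCoeff` is `(c₁, c₂) = (0, 1)`); hence unit content of ANY branch
  through the pair gives two-variable unit content
  (`IsKatzMeasure₂.exists_isUnit_coeff_coeff_of_hasUnitContent_monomialLine`) — the tree-level form of
  "one-variable `μ = 0` on a line ⟹ two-variable `μ = 0`" by which Gillard's theorem on the split-prime
  line (`DeShalit1987.thmIII212_hasUnitContent_katzBranch`) is read on the two-variable frame.

References: E. de Shalit, *Iwasawa theory of elliptic curves with complex multiplication* (1987),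
II.4.17 (51)–(54) [deShalit1987]; L. Washington, *Introduction to Cyclotomic Fields*, §13.1
(`ℤ_p`-extensions, topological generators) [Washington1997]; F. Gouvêa, *p-adic Numbers*, §5.6
[Gouvea1993PadicNumbers].
-/

noncomputable section

open Filter Topology Finset
open NumberField IsDedekindDomain Field
open Literature.NumberTheory.GaloisRepresentations
open Literature.NumberTheory.EllipticCurves.GreenbergVatsal2000

namespace Literature.NumberTheory.EllipticCurves

variable {p : ℕ} [Fact p.Prime]

/-! ### §3. The avatar identity along a `ℤ_p`-line -/

section Avatar

variable {K : Type*} [Field K]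

/-- `σ ↦ r(σ) ∈ ℂ_p` is continuous (`r` is a continuous homomorphism into `GL₁(ℚ̄_p)`, `det` and
`ℚ̄_p ⊆ ℂ_p` are continuous). [cite: Washington1997, §13.1] -/
theorem continuous_avatarValueAt (r : FramedGaloisRep K (PadicAlgCl p) 1) :
    Continuous fun σ ↦ avatarValueAt r σ := by
  have h1 : Continuous fun σ ↦ ((r σ : GL (Fin 1) (PadicAlgCl p)) : Matrix (Fin 1) (Fin 1) (PadicAlgCl p)) :=
    Units.continuous_val.comp (map_continuous r)
  have h2 := (UniformSpace.Completion.continuous_coe (PadicAlgCl p)).comp h1.matrix_det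
  refine h2.congr fun σ ↦ ?_
  simp only [Function.comp_apply, avatarValueAt, Matrix.GeneralLinearGroup.val_det_apply]

/-- `r(σ⁻¹) · r(σ) = 1`. [cite: Washington1997, §13.1] -/
theorem avatarValueAt_inv_mul (r : FramedGaloisRep K (PadicAlgCl p) 1) (σ : absoluteGaloisGroup K) :
    avatarValueAt r σ⁻¹ * avatarValueAt r σ = 1 := by
  rw [← avatarValueAt_mul, inv_mul_cancel, avatarValueAt_one]

/-- **A continuous character of the compact group `Γ_K` has norm `1`**: `‖r(σ)‖ = 1` (the norm is a
continuous multiplicative function with compact, hence bounded, range; a value of norm `> 1` would have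
unbounded powers, and `r(σ⁻¹) = r(σ)⁻¹`). [cite: Washington1997, §13.1] -/
theorem norm_avatarValueAt_eq_one [CharZero K] (r : FramedGaloisRep K (PadicAlgCl p) 1)
    (σ : absoluteGaloisGroup K) : ‖avatarValueAt r σ‖ = 1 := by
  have hcont : Continuous fun τ ↦ ‖avatarValueAt r τ‖ := (continuous_avatarValueAt r).norm
  obtain ⟨τ₀, -, hmax⟩ := isCompact_univ.exists_isMaxOn Set.univ_nonempty hcont.continuousOn
  have hle : ∀ τ, ‖avatarValueAt r τ‖ ≤ ‖avatarValueAt r τ₀‖ := fun τ ↦ hmax (Set.mem_univ τ)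
  set M := ‖avatarValueAt r τ₀‖ with hM
  have hM1 : 1 ≤ M := by simpa using hle 1
  have hMsq : M * M ≤ M := by
    have := hle (τ₀ * τ₀)
    rwa [avatarValueAt_mul, norm_mul] at this
  have hMle : M ≤ 1 := by nlinarith
  have hall : ∀ τ, ‖avatarValueAt r τ‖ ≤ 1 := fun τ ↦ (hle τ).trans hMle
  have hprod : ‖avatarValueAt r σ⁻¹‖ * ‖avatarValueAt r σ‖ = 1 := by
    rw [← norm_mul, avatarValueAt_inv_mul, norm_one]
  have h1 := hall σ⁻¹
  have h2 := hall σ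
  nlinarith [norm_nonneg (avatarValueAt r σ⁻¹), norm_nonneg (avatarValueAt r σ)]

namespace ZpExtension

variable (κ : ZpExtension K p) (r : FramedGaloisRep K (PadicAlgCl p) 1)

/-- A section of `κ`: some `σ_c ∈ Γ_K` with `κ(σ_c) = c`. [cite: Washington1997, §13.1] -/
def lift (c : ℤ_[p]) : absoluteGaloisGroup K := (κ.surjective (Multiplicative.ofAdd c)).choose

/-- `κ(σ_c) = c`. [cite: Washington1997, §13.1] -/
theorem apply_lift (c : ℤ_[p]) : κ (κ.lift c) = Multiplicative.ofAdd c :=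
  (κ.surjective (Multiplicative.ofAdd c)).choose_spec

/-- **The character of `ℤ_p = Gal(K_∞/K)` induced by `r`**: `c ↦ r(σ_c)` (well defined when `r`
factors through `κ`, `lineChar_eq`). [cite: Washington1997, §13.1] -/
def lineChar (c : ℤ_[p]) : ℂ_[p] := avatarValueAt r (κ.lift c)

variable {κ r}

/-- If `r` factors through `κ`, `r(σ)` depends only on `κ(σ)`. [cite: Washington1997, §13.1] -/
theorem avatarValueAt_eq_of_apply_eq (h : FactorsThroughZp κ r) {σ τ : absoluteGaloisGroup K}
    (hστ : κ σ = κ τ) : avatarValueAt r σ = avatarValueAt r τ := by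
  have h1 : κ (σ * τ⁻¹) = 1 := by rw [map_mul, map_inv, hστ, mul_inv_cancel]
  have h2 : avatarValueAt r (σ * τ⁻¹) = 1 := avatarValueAt_eq_one_of_factorsThroughZp h h1
  calc avatarValueAt r σ = avatarValueAt r (σ * τ⁻¹ * τ) := by rw [inv_mul_cancel_right]
    _ = avatarValueAt r τ := by rw [avatarValueAt_mul, h2, one_mul]

/-- `r(σ) = χ(κ(σ))` for the induced character `χ = lineChar κ r`. [cite: Washington1997, §13.1] -/
theorem lineChar_eq (h : FactorsThroughZp κ r) (σ : absoluteGaloisGroup K) :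
    κ.lineChar r (Multiplicative.toAdd (κ σ)) = avatarValueAt r σ :=
  avatarValueAt_eq_of_apply_eq h (by rw [apply_lift, ofAdd_toAdd])

/-- The induced character is additive-to-multiplicative. [cite: Washington1997, §13.1] -/
theorem lineChar_add (h : FactorsThroughZp κ r) (a b : ℤ_[p]) :
    κ.lineChar r (a + b) = κ.lineChar r a * κ.lineChar r b := by
  have h1 : κ (κ.lift a * κ.lift b) = Multiplicative.ofAdd (a + b) := by
    rw [map_mul, apply_lift, apply_lift, ofAdd_add]
  rw [lineChar, lineChar, lineChar, ← avatarValueAt_mul]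
  exact avatarValueAt_eq_of_apply_eq h (by rw [apply_lift, h1])

/-- `χ(0) = 1`. [cite: Washington1997, §13.1] -/
theorem lineChar_zero (h : FactorsThroughZp κ r) : κ.lineChar r 0 = 1 := by
  have h1 : κ (κ.lift 0) = κ 1 := by rw [apply_lift, map_one, ofAdd_zero]
  rw [lineChar, avatarValueAt_eq_of_apply_eq h h1, avatarValueAt_one]

/-- `χ(1) = r(γ)` for a topological generator `γ` (`κ(γ) = 1`). [cite: Washington1997, §13.1] -/
theorem lineChar_one (h : FactorsThroughZp κ r) {γ : absoluteGaloisGroup K} (hγ : κ.IsTopGenerator γ) :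
    κ.lineChar r 1 = avatarValueAt r γ := by
  have hγ' : κ γ = Multiplicative.ofAdd 1 := hγ
  rw [← lineChar_eq h γ, hγ', toAdd_ofAdd]

/-- `χ(m) = χ(1)^m` on `ℕ`. [cite: Washington1997, §13.1] -/
theorem lineChar_natCast (h : FactorsThroughZp κ r) (m : ℕ) :
    κ.lineChar r (m : ℤ_[p]) = κ.lineChar r 1 ^ m := by
  induction m with
  | zero => rw [Nat.cast_zero, pow_zero, lineChar_zero h]
  | succ m ih => rw [Nat.cast_succ, lineChar_add h, ih, pow_succ]

/-- `σ ↦ κ(σ) ∈ ℤ_p` (additive coordinates) is a QUOTIENT MAP: a continuous surjection from the compact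
group `Γ_K` onto the Hausdorff space `ℤ_p`. [cite: Washington1997, §13.1] -/
theorem isQuotientMap_toAdd [CharZero K] (κ : ZpExtension K p) :
    IsQuotientMap fun σ : absoluteGaloisGroup K ↦ Multiplicative.toAdd (κ σ) := by
  have hc : Continuous fun σ : absoluteGaloisGroup K ↦ Multiplicative.toAdd (κ σ) :=
    continuous_toAdd.comp (map_continuous κ)
  have hs : Function.Surjective fun σ : absoluteGaloisGroup K ↦ Multiplicative.toAdd (κ σ) :=
    fun c ↦ ⟨κ.lift c, by simp only [apply_lift, toAdd_ofAdd]⟩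
  exact hc.isClosedMap.isQuotientMap hc hs

/-- **The induced character is continuous on `ℤ_p`** (its pull-back to `Γ_K` along the quotient map `κ` is
the continuous `σ ↦ r(σ)`). [cite: Washington1997, §13.1] -/
theorem continuous_lineChar [CharZero K] (h : FactorsThroughZp κ r) : Continuous (κ.lineChar r) := by
  rw [(isQuotientMap_toAdd κ).continuous_iff]
  have : (κ.lineChar r ∘ fun σ : absoluteGaloisGroup K ↦ Multiplicative.toAdd (κ σ)) =
      fun σ ↦ avatarValueAt r σ := funext fun σ ↦ lineChar_eq h σ
  rw [this]
  exact continuous_avatarValueAt r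

/-- The residue of `x ∈ 𝒪_{ℂ_p}` vanishes iff `‖x‖ < 1`. [cite: Gouvea1993PadicNumbers, §5.6] -/
private theorem residue_eq_zero_iff (x : PadicComplexInt p) :
    IsLocalRing.residue (PadicComplexInt p) x = 0 ↔ ‖(x : ℂ_[p])‖ < 1 := by
  rw [IsLocalRing.residue_eq_zero_iff, IsLocalRing.mem_maximalIdeal, mem_nonunits_iff,
    isUnit_padicComplexInt_iff]
  exact ⟨fun h' => lt_of_le_of_ne (norm_coe_padicComplexInt_le_one x) h', fun h' => h'.ne⟩

/-- The residue field of `𝒪_{ℂ_p}` has characteristic `p` (`‖p‖ < 1`). [cite: Gouvea1993PadicNumbers, §5.6] -/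
private theorem charP_residueField : CharP (IsLocalRing.ResidueField (PadicComplexInt p)) p := by
  rw [CharP.charP_iff_prime_eq_zero (Fact.out : p.Prime)]
  have hp : ((p : PadicComplexInt p) : ℂ_[p]) = ((p : ℚ_[p]) : ℂ_[p]) := by simp
  rw [← map_natCast (IsLocalRing.residue (PadicComplexInt p)), residue_eq_zero_iff, hp,
    PadicComplex.norm_extends']
  exact Padic.norm_p_lt_one

/-- **A unit `u` of `𝒪_{ℂ_p}` with `‖u^{pᴺ} − 1‖ < 1` is a principal unit** (`ū^{pᴺ} = 1` in the residue field
of characteristic `p`, where `pᴺ`-th powers are injective, so `ū = 1`). [cite: Gouvea1993PadicNumbers, §5.6] -/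
theorem norm_sub_one_lt_one_of_pow_prime_pow {u : ℂ_[p]} (hu : ‖u‖ ≤ 1) (N : ℕ)
    (h : ‖u ^ p ^ N - 1‖ < 1) : ‖u - 1‖ < 1 := by
  haveI := charP_residueField (p := p)
  haveI : ExpChar (IsLocalRing.ResidueField (PadicComplexInt p)) p := ExpChar.prime Fact.out
  set U : PadicComplexInt p := ⟨u, mem_padicComplexInt_iff.mpr hu⟩ with hU
  have hres : IsLocalRing.residue (PadicComplexInt p) (U ^ p ^ N - 1) = 0 := by
    rw [residue_eq_zero_iff]
    simpa [hU] using h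
  rw [map_sub, map_pow, map_one, sub_eq_zero] at hres
  have h1 : IsLocalRing.residue (PadicComplexInt p) U = 1 := by
    apply iterateFrobenius_inj (IsLocalRing.ResidueField (PadicComplexInt p)) p N
    rw [iterateFrobenius_def, iterateFrobenius_def, hres, one_pow]
  have h2 : IsLocalRing.residue (PadicComplexInt p) (U - 1) = 0 := by
    rw [map_sub, h1, map_one, sub_self]
  rw [residue_eq_zero_iff] at h2
  simpa [hU] using h2

/-- **`‖r(γ) − 1‖ < 1`**: a continuous character of `Γ_K` through the pro-`p` quotient `κ` takes principal-unit
values (`χ` is continuous at `0` with `χ(0) = 1`, so `‖χ(pᴺ) − 1‖ < 1` for large `N`; `χ(pᴺ) = r(γ)^{pᴺ}` and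
the previous lemma). [cite: Washington1997, §13.1] -/
theorem norm_avatarValueAt_sub_one_lt [CharZero K] (h : FactorsThroughZp κ r) {γ : absoluteGaloisGroup K}
    (hγ : κ.IsTopGenerator γ) : ‖avatarValueAt r γ - 1‖ < 1 := by
  have hc := continuous_lineChar h
  have hp1 : ‖(p : ℤ_[p])‖ < 1 := by
    rw [PadicInt.norm_p]
    exact inv_lt_one_of_one_lt₀ (by exact_mod_cast (Fact.out : p.Prime).one_lt)
  have h0 : Tendsto (fun N : ℕ ↦ ((p : ℤ_[p]) ^ N)) atTop (𝓝 0) :=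
    tendsto_pow_atTop_nhds_zero_of_norm_lt_one hp1
  have h1 : Tendsto (fun N : ℕ ↦ κ.lineChar r ((p : ℤ_[p]) ^ N)) atTop (𝓝 1) := by
    rw [← lineChar_zero h]
    exact (hc.tendsto 0).comp h0
  have h2 : ∀ᶠ N : ℕ in atTop, ‖κ.lineChar r ((p : ℤ_[p]) ^ N) - 1‖ < 1 := by
    have := (tendsto_iff_norm_sub_tendsto_zero.mp h1)
    exact this.eventually (gt_mem_nhds zero_lt_one)
  obtain ⟨N, hN⟩ := h2.exists
  have h3 : κ.lineChar r ((p : ℤ_[p]) ^ N) = avatarValueAt r γ ^ p ^ N := by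
    rw [← lineChar_one h hγ, show ((p : ℤ_[p]) ^ N) = ((p ^ N : ℕ) : ℤ_[p]) by push_cast; rfl,
      lineChar_natCast h]
  rw [h3] at hN
  exact norm_sub_one_lt_one_of_pow_prime_pow (norm_avatarValueAt_eq_one r γ).le N hN

/-- **The avatar identity `r(σ) = (1 + (r(γ) − 1))^{κ(σ)}`** for `r` factoring through `κ` and `γ` a
topological generator: both sides are continuous characters of `ℤ_p` in `κ(σ)` (the left through the
quotient map `κ`, the right by Mahler continuity of the binomial series on the open disc) and they agree
on `ℕ ⊆ ℤ_p`, which is dense. This is "`ρ(γ₀^a) = ρ(γ₀)^a`" behind de Shalit's (52)–(53).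
[cite: deShalit1987, II.4.17 (52)–(53) (p. 77)] [cite: Washington1997, §13.1] -/
theorem avatarValueAt_eq_onePlusPow [CharZero K] (h : FactorsThroughZp κ r) {γ : absoluteGaloisGroup K}
    (hγ : κ.IsTopGenerator γ) (σ : absoluteGaloisGroup K) :
    avatarValueAt r σ =
      IntSeries.onePlusPow (Multiplicative.toAdd (κ σ)) (avatarValueAt r γ - 1) := by
  rw [← lineChar_eq h σ]
  have hx := norm_avatarValueAt_sub_one_lt h hγ
  have key : κ.lineChar r = fun c ↦ IntSeries.onePlusPow c (avatarValueAt r γ - 1) := by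
    apply Continuous.ext_on PadicInt.denseRange_natCast (continuous_lineChar h)
      (IntSeries.continuous_onePlusPow hx)
    rintro _ ⟨m, rfl⟩
    simp only [lineChar_natCast h, IntSeries.onePlusPow_natCast, lineChar_one h hγ, add_sub_cancel]
  exact congrFun key _

end ZpExtension

end Avatar

/-! ### §4. The frame corollary: every sub-`ℤ_p`-line of a two-variable frame is a one-variable frame -/

section Frame

variable {K : Type} [Field K] [NumberField K]
  {ι : PadicAlgCl p ≃+* ℂ} {v vbar : HeightOneSpectrum (𝓞 K)} {S : Finset (HeightOneSpectrum (𝓞 K))}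
  {κ₁ κ₂ : ZpExtension K p} {γ₁ γ₂ : absoluteGaloisGroup K} {lam : HeckeCharacter K} {Ω δ : ℂ}
  {Ωp : ℂ_[p]} {G : PowerSeries (PowerSeries (PadicComplexInt p))}

/-- **`IsKatzMeasure₂ ⟹ IsKatzBranch` along every `ℤ_p`-line through the pair.** If `G` is the
`λ`-twisted two-variable frame for `(κ₁, κ₂; γ₁, γ₂)`, `κ` a `ℤ_p`-quotient of `Γ_K` with
`ker κ₁ ∩ ker κ₂ ≤ ker κ` (a line of the `ℤ_p²`-tower) and `γ` a topological generator of `κ`, then the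
monomial line `G((1+T)^{κ(γ₁)} − 1, (1+T)^{κ(γ₂)} − 1)` is the `λ`-twisted `κ`-BRANCH at `γ`
(`DeShalit1987.IsKatzBranch`): a character `ρ` of the line is a character of the pair, its point
`(ρ̂(γ₁) − 1, ρ̂(γ₂) − 1)` is `((1+x)^{κ(γ₁)} − 1, (1+x)^{κ(γ₂)} − 1)` with `x = ρ̂(γ) − 1` (§3), and the
prescribed values (50) are the same. de Shalit's "(52) for the restriction of (54) to a line".
[cite: deShalit1987, II.4.17 (51)–(54) (p. 77–78)] -/
theorem IsKatzMeasure₂.isKatzBranch_monomialLine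
    (hG : IsKatzMeasure₂ ι v vbar S κ₁ κ₂ γ₁ γ₂ lam Ω δ Ωp G) {κ : ZpExtension K p}
    (hκ : ZpExtension.pairKer κ₁ κ₂ ≤ κ.kerSubgroup) {γ : absoluteGaloisGroup K}
    (hγ : κ.IsTopGenerator γ) :
    DeShalit1987.IsKatzBranch ι v vbar S κ γ lam Ω δ Ωp
      (IntSeries.monomialLine (Multiplicative.toAdd (κ γ₁)) (Multiplicative.toAdd (κ γ₂)) G) := by
  intro ρ r m j hr hκr hjm hinf hunr hL
  have hpair : FactorsThroughPair κ₁ κ₂ r := by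
    intro σ h₁ h₂
    refine hκr σ (ZpExtension.mem_kerSubgroup.mp (hκ ?_))
    exact ZpExtension.mem_pairKer_iff.mpr ⟨ZpExtension.mem_kerSubgroup.mpr h₁,
      ZpExtension.mem_kerSubgroup.mpr h₂⟩
  have hval := hG ρ r m j hr hpair hjm hinf hunr hL
  have hx := ZpExtension.norm_avatarValueAt_sub_one_lt hκr hγ
  rw [IntSeries.hasValueAt_monomialLine_iff _ _ G hx,
    ← ZpExtension.avatarValueAt_eq_onePlusPow hκr hγ γ₁,
    ← ZpExtension.avatarValueAt_eq_onePlusPow hκr hγ γ₂]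
  exact hval

omit [NumberField K] in
/-- **Unit content of one branch gives two-variable unit content**: in the setting of
`isKatzBranch_monomialLine`, if the `κ`-branch (monomial line) has a unit coefficient then so has `G`.
This is the tree-level form of "one-variable `μ = 0` on a line ⟹ two-variable `μ = 0`" used to read
Gillard's theorem (`DeShalit1987.thmIII212_hasUnitContent_katzBranch`) on the two-variable frame.
[cite: deShalit1987, II.4.17 (51)–(54) (p. 77–78)] -/
theorem IsKatzMeasure₂.exists_isUnit_coeff_coeff_of_hasUnitContent_monomialLine
    {κ : ZpExtension K p}
    (h : HasUnitContent
      (IntSeries.monomialLine (Multiplicative.toAdd (κ γ₁)) (Multiplicative.toAdd (κ γ₂)) G)) :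
    ∃ i n : ℕ, IsUnit (PowerSeries.coeff n (PowerSeries.coeff i G)) :=
  IntSeries.exists_isUnit_coeff_coeff_of_hasUnitContent_monomialLine h

end Frame

end Literature.NumberTheory.EllipticCurves
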